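import Summits.CriticalPhenomena.SAWScalingLimit.Theorems.SAWRenewalTightnessTubeLowerBoundDefs

/-!
# Crux `SAWRenewalTightness.TubeLowerBound` (stmt-CriticalPhenomena-4730), line `lieb-simon-star`: the octant reduction

Stub `stub_octantReduction : FirstOctantTubeFloor → TightTubeFloor` of the checked skeleton of the line
`lieb-simon-star`: the crux at its own scale `ℓ₀ = max(1, |u − v|)` for all `u v : ℤ²` follows from its
first-octant instance `u = 0`, `v = (a, b)`, `0 ≤ b ≤ a`, by pure symmetry transport:

* translation invariance of the double sum (`Site.toComplex` is additive, `segment_translate_image`,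
  `Metric.infDist_image` for the isometry `z ↦ c + z`), reducing `(u, v)` to `(0, v − u)`;
* the three involutive lattice isometries of `ℤ²` fixing `0` — `(p, q) ↦ (−p, q)`, `(p, q) ↦ (p, −q)` and
  the swap `(p, q) ↦ (q, p)` — each mapping `Zd.sawFun 2 n w` bijectively onto `Zd.sawFun 2 n (g w)` and
  having a real-linear isometry of `ℂ` as companion, so that the tube predicate, the radius
  `max(1, |w|)/10 + 2` and the floor `c · max(1, |w|)^{−C}` are unchanged;
* the normal form: every `w ∈ ℤ²` is brought into the first octant `(a, b)`, `0 ≤ b ≤ a`, by these moves.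

The double sums are handled through the landed `Negative.tubeMass`.  Same `C`, `c` and `N` as the hypothesis.
-/

noncomputable section

namespace Summit.CriticalPhenomena.SAWScalingLimit.Theorems.TubeLowerBound.LiebSimonStar

open scoped BigOperators Classical
open Literature.Probability.LatticeModels
open Literature.Probability.RandomPlanarGeometry Literature.Probability.RandomPlanarGeometry.SAW

namespace OctantReduction

/-! ### The tube mass from the origin, translation -/

/-- The tube mass from the origin, without the `0 +` / `− 0` bookkeeping of `Negative.tubeMass`. -/
theorem tubeMass_zero_eq (x : ℝ) (w : Site 2) (r : ℝ) (N : ℕ) :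
    Negative.tubeMass x 0 w r N = ∑ n ∈ Finset.range (N + 1), ∑ _ω ∈ (Zd.sawFun 2 n w).filter
      (fun ω => ∀ i ≤ n, Metric.infDist (Site.toComplex (ω i))
        (segment ℝ (Site.toComplex (0 : Site 2)) (Site.toComplex w)) ≤ r), x ^ n := by
  unfold Negative.tubeMass
  refine Finset.sum_congr rfl fun n _ => Finset.sum_congr ?_ fun _ _ => rfl
  rw [sub_zero]
  exact Finset.filter_congr fun ω _ => by simp only [zero_add]

/-- **Translation invariance** of the tube mass: `(u, v) ↦ (0, v − u)`. -/
theorem tubeMass_translate (x : ℝ) (u v : Site 2) (r : ℝ) (N : ℕ) :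
    Negative.tubeMass x u v r N = Negative.tubeMass x 0 (v - u) r N := by
  rw [tubeMass_zero_eq]
  unfold Negative.tubeMass
  refine Finset.sum_congr rfl fun n _ => Finset.sum_congr ?_ fun _ _ => rfl
  refine Finset.filter_congr fun ω _ => ?_
  have hadd : ∀ p q : Site 2, Site.toComplex (p + q) = Site.toComplex p + Site.toComplex q :=
    fun p q => Complex.ext (by simp) (by simp)
  have h0 : Site.toComplex (0 : Site 2) = 0 := Complex.ext (by simp) (by simp)
  have hseg : segment ℝ (Site.toComplex u) (Site.toComplex v) =
      (fun z => Site.toComplex u + z) '' segment ℝ (Site.toComplex (0 : Site 2)) (Site.toComplex (v - u)) := by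
    rw [segment_translate_image, h0, add_zero, ← hadd, add_sub_cancel]
  have key : ∀ p : Site 2,
      Metric.infDist (Site.toComplex (u + p)) (segment ℝ (Site.toComplex u) (Site.toComplex v)) =
      Metric.infDist (Site.toComplex p) (segment ℝ (Site.toComplex (0 : Site 2)) (Site.toComplex (v - u))) := by
    intro p
    rw [hseg, hadd]
    exact Metric.infDist_image (isometry_add_left _)
  simp only [key]

/-- Translation invariance of the distance: `|u − v| = |0 − (v − u)|`. -/
theorem dist_translate (u v : Site 2) :
    dist (Site.toComplex u) (Site.toComplex v) = dist (Site.toComplex (0 : Site 2)) (Site.toComplex (v - u)) := by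
  have hsub : Site.toComplex (v - u) = Site.toComplex v - Site.toComplex u := Complex.ext (by simp) (by simp)
  have h0 : Site.toComplex (0 : Site 2) = 0 := Complex.ext (by simp) (by simp)
  rw [dist_comm, Complex.dist_eq, Complex.dist_eq, h0, zero_sub, norm_neg, hsub]

/-! ### Lattice isometries fixing the origin -/

/-- Adjacency in `ℤ²` in coordinates: one coordinate agrees and the other differs by `1`. -/
theorem adj_iff_coord (p q : Site 2) : (zdGraph 2).Adj p q ↔
    (q 0 = p 0 + 1 ∧ q 1 = p 1 ∨ q 0 = p 0 ∧ q 1 = p 1 + 1) ∨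
      (p 0 = q 0 + 1 ∧ p 1 = q 1 ∨ p 0 = q 0 ∧ p 1 = q 1 + 1) := by
  have key : ∀ a b : Site 2, (∃ i : Fin 2, b = a + Pi.single i 1) ↔
      (b 0 = a 0 + 1 ∧ b 1 = a 1 ∨ b 0 = a 0 ∧ b 1 = a 1 + 1) := by
    intro a b
    constructor
    · rintro ⟨i, rfl⟩
      fin_cases i <;> simp
    · rintro (⟨h0, h1⟩ | ⟨h0, h1⟩)
      · exact ⟨0, funext fun j => by fin_cases j <;> simp [h0, h1]⟩
      · exact ⟨1, funext fun j => by fin_cases j <;> simp [h0, h1]⟩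
  rw [zdGraph_adj_iff, exists_or, key, key]

/-- A lattice map `g` fixing `0`, injective and preserving adjacency, with a real-linear isometry `T` of `ℂ`
as companion (`toComplex ∘ g = T ∘ toComplex`), maps the tube set of walks `0 → w` into the tube set of
walks `0 → g w` (same length, same radius). -/
theorem map_mem_tubeSet (g : Site 2 → Site 2) (T : ℂ →ₗᵢ[ℝ] ℂ) (hg : Function.Injective g)
    (hg0 : g 0 = 0) (hadj : ∀ p q : Site 2, (zdGraph 2).Adj p q → (zdGraph 2).Adj (g p) (g q))
    (hT : ∀ s, Site.toComplex (g s) = T (Site.toComplex s)) {n : ℕ} {w : Site 2} {r : ℝ}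
    {ω : ℕ → Site 2}
    (hω : ω ∈ (Zd.sawFun 2 n w).filter (fun ω => ∀ i ≤ n, Metric.infDist (Site.toComplex (ω i))
        (segment ℝ (Site.toComplex (0 : Site 2)) (Site.toComplex w)) ≤ r)) :
    (fun i => g (ω i)) ∈ (Zd.sawFun 2 n (g w)).filter (fun ω => ∀ i ≤ n,
        Metric.infDist (Site.toComplex (ω i))
          (segment ℝ (Site.toComplex (0 : Site 2)) (Site.toComplex (g w))) ≤ r) := by
  simp only [Finset.mem_filter] at hω ⊢
  obtain ⟨hω, htube⟩ := hω
  obtain ⟨h0, hend, hadj', hinj⟩ := Zd.mem_sawFun.1 hω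
  refine ⟨Zd.mem_sawFun.2 ⟨by rw [h0, hg0], fun i hi => by rw [hend i hi],
    fun i hi => hadj _ _ (hadj' i hi), fun i hi j hj hij => hinj hi hj (hg hij)⟩, fun i hi => ?_⟩
  have h0T : Site.toComplex (0 : Site 2) = T (Site.toComplex 0) := by
    have := hT 0
    rwa [hg0] at this
  have hseg : segment ℝ (Site.toComplex (0 : Site 2)) (Site.toComplex (g w)) =
      T '' segment ℝ (Site.toComplex (0 : Site 2)) (Site.toComplex w) := by
    have := image_segment ℝ T.toLinearMap.toAffineMap (Site.toComplex 0) (Site.toComplex w)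
    simp only [LinearMap.coe_toAffineMap, LinearIsometry.coe_toLinearMap] at this
    rw [this, ← h0T, hT]
  rw [hseg, hT, Metric.infDist_image T.isometry]
  exact htube i hi

/-- **Symmetry transport of the tube mass**: for an involutive lattice map `g` fixing `0` and preserving
adjacency, with a real-linear isometry of `ℂ` as companion, the tube masses from `0` to `g w` and to `w`
agree (the map `ω ↦ g ∘ ω` is a bijection of the tube sets). -/
theorem tubeMass_symm (g : Site 2 → Site 2) (T : ℂ →ₗᵢ[ℝ] ℂ) (hgg : Function.Involutive g)
    (hg0 : g 0 = 0) (hadj : ∀ p q : Site 2, (zdGraph 2).Adj p q → (zdGraph 2).Adj (g p) (g q))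
    (hT : ∀ s, Site.toComplex (g s) = T (Site.toComplex s)) (x : ℝ) (w : Site 2) (r : ℝ) (N : ℕ) :
    Negative.tubeMass x 0 (g w) r N = Negative.tubeMass x 0 w r N := by
  rw [tubeMass_zero_eq, tubeMass_zero_eq]
  refine Finset.sum_congr rfl fun n _ => ?_
  refine Finset.sum_nbij' (fun ω i => g (ω i)) (fun ω i => g (ω i)) ?_ ?_ ?_ ?_ fun _ _ => rfl
  · intro ω hω
    have := map_mem_tubeSet g T hgg.injective hg0 hadj hT hω
    simpa only [hgg w] using this
  · intro ω hω
    exact map_mem_tubeSet g T hgg.injective hg0 hadj hT hω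
  · intro ω _
    funext i
    exact hgg _
  · intro ω _
    funext i
    exact hgg _

/-- The companion isometry preserves the distance from the origin: `|g w| = |w|`. -/
theorem dist_symm (g : Site 2 → Site 2) (T : ℂ →ₗᵢ[ℝ] ℂ) (hg0 : g 0 = 0)
    (hT : ∀ s, Site.toComplex (g s) = T (Site.toComplex s)) (w : Site 2) :
    dist (Site.toComplex (0 : Site 2)) (Site.toComplex (g w)) =
      dist (Site.toComplex (0 : Site 2)) (Site.toComplex w) := by
  have h0T : Site.toComplex (0 : Site 2) = T (Site.toComplex 0) := by
    have := hT 0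
    rwa [hg0] at this
  calc dist (Site.toComplex (0 : Site 2)) (Site.toComplex (g w))
      = dist (T (Site.toComplex 0)) (T (Site.toComplex w)) := by rw [← h0T, hT]
    _ = dist (Site.toComplex (0 : Site 2)) (Site.toComplex w) := T.isometry.dist_eq _ _

/-- The companion of `(p, q) ↦ (−p, q)`: the real-linear isometry `z ↦ −z̄` of `ℂ`. -/
theorem exists_isometry_negRe : ∃ T : ℂ →ₗᵢ[ℝ] ℂ, ∀ z : ℂ, T z = ⟨-z.re, z.im⟩ :=
  ⟨{ toFun := fun z => ⟨-z.re, z.im⟩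
     map_add' := fun a b => Complex.ext (by simp; ring) (by simp)
     map_smul' := fun t a => Complex.ext (by simp) (by simp)
     norm_map' := fun z => by simp [Complex.norm_def, Complex.normSq_apply] }, fun _ => rfl⟩

/-- The companion of `(p, q) ↦ (p, −q)`: complex conjugation `z ↦ z̄`. -/
theorem exists_isometry_negIm : ∃ T : ℂ →ₗᵢ[ℝ] ℂ, ∀ z : ℂ, T z = ⟨z.re, -z.im⟩ :=
  ⟨{ toFun := fun z => ⟨z.re, -z.im⟩
     map_add' := fun a b => Complex.ext (by simp) (by simp; ring)
     map_smul' := fun t a => Complex.ext (by simp) (by simp)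
     norm_map' := fun z => by simp [Complex.norm_def, Complex.normSq_apply] }, fun _ => rfl⟩

/-- The companion of the swap `(p, q) ↦ (q, p)`: the real-linear isometry `z ↦ i z̄` of `ℂ`. -/
theorem exists_isometry_swap : ∃ T : ℂ →ₗᵢ[ℝ] ℂ, ∀ z : ℂ, T z = ⟨z.im, z.re⟩ :=
  ⟨{ toFun := fun z => ⟨z.im, z.re⟩
     map_add' := fun a b => Complex.ext (by simp) (by simp)
     map_smul' := fun t a => Complex.ext (by simp) (by simp)
     norm_map' := fun z => by simp [Complex.norm_def, Complex.normSq_apply, add_comm] }, fun _ => rfl⟩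

/-- `(p, q) ↦ (−p, q)` preserves adjacency. -/
theorem adj_negX {p q : Site 2} (h : (zdGraph 2).Adj p q) :
    (zdGraph 2).Adj (![-(p 0), p 1] : Site 2) ![-(q 0), q 1] := by
  rw [adj_iff_coord] at h ⊢
  simp only [Matrix.cons_val_zero, Matrix.cons_val_one]
  omega

/-- `(p, q) ↦ (p, −q)` preserves adjacency. -/
theorem adj_negY {p q : Site 2} (h : (zdGraph 2).Adj p q) :
    (zdGraph 2).Adj (![p 0, -(p 1)] : Site 2) ![q 0, -(q 1)] := by
  rw [adj_iff_coord] at h ⊢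
  simp only [Matrix.cons_val_zero, Matrix.cons_val_one]
  omega

/-- The swap `(p, q) ↦ (q, p)` preserves adjacency. -/
theorem adj_swap {p q : Site 2} (h : (zdGraph 2).Adj p q) :
    (zdGraph 2).Adj (![p 1, p 0] : Site 2) ![q 1, q 0] := by
  rw [adj_iff_coord] at h ⊢
  simp only [Matrix.cons_val_zero, Matrix.cons_val_one]
  omega

/-- **Invariance under `(p, q) ↦ (−p, q)`** of the distance from `0` and of every tube mass from `0`. -/
theorem symm_negX (w : Site 2) :
    dist (Site.toComplex (0 : Site 2)) (Site.toComplex (![-(w 0), w 1] : Site 2)) =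
        dist (Site.toComplex (0 : Site 2)) (Site.toComplex w) ∧
      ∀ (x r : ℝ) (N : ℕ),
        Negative.tubeMass x 0 (![-(w 0), w 1] : Site 2) r N = Negative.tubeMass x 0 w r N := by
  obtain ⟨T, hTz⟩ := exists_isometry_negRe
  have hT : ∀ s : Site 2, Site.toComplex ((fun s : Site 2 => (![-(s 0), s 1] : Site 2)) s) =
      T (Site.toComplex s) := fun s => Complex.ext (by simp [hTz]) (by simp [hTz])
  have hg0 : (fun s : Site 2 => (![-(s 0), s 1] : Site 2)) 0 = 0 := by
    funext j; fin_cases j <;> simp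
  refine ⟨dist_symm _ T hg0 hT w,
    fun x r N => tubeMass_symm _ T (fun s => ?_) hg0 (fun p q h => adj_negX h) hT x w r N⟩
  funext j; fin_cases j <;> simp

/-- **Invariance under `(p, q) ↦ (p, −q)`** of the distance from `0` and of every tube mass from `0`. -/
theorem symm_negY (w : Site 2) :
    dist (Site.toComplex (0 : Site 2)) (Site.toComplex (![w 0, -(w 1)] : Site 2)) =
        dist (Site.toComplex (0 : Site 2)) (Site.toComplex w) ∧
      ∀ (x r : ℝ) (N : ℕ),
        Negative.tubeMass x 0 (![w 0, -(w 1)] : Site 2) r N = Negative.tubeMass x 0 w r N := by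
  obtain ⟨T, hTz⟩ := exists_isometry_negIm
  have hT : ∀ s : Site 2, Site.toComplex ((fun s : Site 2 => (![s 0, -(s 1)] : Site 2)) s) =
      T (Site.toComplex s) := fun s => Complex.ext (by simp [hTz]) (by simp [hTz])
  have hg0 : (fun s : Site 2 => (![s 0, -(s 1)] : Site 2)) 0 = 0 := by
    funext j; fin_cases j <;> simp
  refine ⟨dist_symm _ T hg0 hT w,
    fun x r N => tubeMass_symm _ T (fun s => ?_) hg0 (fun p q h => adj_negY h) hT x w r N⟩
  funext j; fin_cases j <;> simp

/-- **Invariance under the swap `(p, q) ↦ (q, p)`** of the distance from `0` and of every tube mass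
from `0`. -/
theorem symm_swap (w : Site 2) :
    dist (Site.toComplex (0 : Site 2)) (Site.toComplex (![w 1, w 0] : Site 2)) =
        dist (Site.toComplex (0 : Site 2)) (Site.toComplex w) ∧
      ∀ (x r : ℝ) (N : ℕ),
        Negative.tubeMass x 0 (![w 1, w 0] : Site 2) r N = Negative.tubeMass x 0 w r N := by
  obtain ⟨T, hTz⟩ := exists_isometry_swap
  have hT : ∀ s : Site 2, Site.toComplex ((fun s : Site 2 => (![s 1, s 0] : Site 2)) s) =
      T (Site.toComplex s) := fun s => Complex.ext (by simp [hTz]) (by simp [hTz])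
  have hg0 : (fun s : Site 2 => (![s 1, s 0] : Site 2)) 0 = 0 := by
    funext j; fin_cases j <;> simp
  refine ⟨dist_symm _ T hg0 hT w,
    fun x r N => tubeMass_symm _ T (fun s => ?_) hg0 (fun p q h => adj_swap h) hT x w r N⟩
  funext j; fin_cases j <;> simp

/-! ### Normal form: reduction to the first octant -/

/-- **Octant induction**: a property of sites of `ℤ²` that descends along the three generating lattice
isometries `(p, q) ↦ (−p, q)`, `(p, q) ↦ (p, −q)`, `(p, q) ↦ (q, p)` and holds on the first octant
`{(a, b) : 0 ≤ b ≤ a}` holds everywhere. -/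
theorem octant_induction {P : Site 2 → Prop}
    (hx : ∀ w : Site 2, P ![-(w 0), w 1] → P w) (hy : ∀ w : Site 2, P ![w 0, -(w 1)] → P w)
    (hsw : ∀ w : Site 2, P ![w 1, w 0] → P w)
    (hoct : ∀ a b : ℕ, b ≤ a → P ![(a : ℤ), (b : ℤ)]) (w : Site 2) : P w := by
  have habs0 : ∀ v : Site 2, P ![|v 0|, v 1] → P v := by
    intro v hv
    rcases le_or_gt 0 (v 0) with h | h
    · rw [abs_of_nonneg h] at hv
      have e : (![v 0, v 1] : Site 2) = v := by funext j; fin_cases j <;> rfl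
      rwa [e] at hv
    · rw [abs_of_neg h] at hv
      exact hx v hv
  have habs1 : ∀ v : Site 2, P ![v 0, |v 1|] → P v := by
    intro v hv
    rcases le_or_gt 0 (v 1) with h | h
    · rw [abs_of_nonneg h] at hv
      have e : (![v 0, v 1] : Site 2) = v := by funext j; fin_cases j <;> rfl
      rwa [e] at hv
    · rw [abs_of_neg h] at hv
      exact hy v hv
  have hswap : ∀ p q : ℤ, P ![q, p] → P ![p, q] := fun p q h => hsw _ (by simpa using h)
  have key : ∀ p q : ℤ, 0 ≤ q → q ≤ p → P ![p, q] := by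
    intro p q hq hqp
    have := hoct p.toNat q.toNat (Int.toNat_le_toNat hqp)
    rwa [Int.toNat_of_nonneg hq, Int.toNat_of_nonneg (hq.trans hqp)] at this
  apply habs0
  apply habs1
  simp only [Matrix.cons_val_zero, Matrix.cons_val_one]
  rcases le_total |w 1| |w 0| with h | h
  · exact key _ _ (abs_nonneg _) h
  · exact hswap _ _ (key _ _ (abs_nonneg _) h)

end OctantReduction

/-! ### The stub -/

open OctantReduction in
/-- **Stub `octantReduction`** of the line `lieb-simon-star`: the crux at its own scale, `TightTubeFloor`, follows
from its first-octant instance `FirstOctantTubeFloor` by translation invariance and the lattice isometries of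
`ℤ²` fixing the origin (same `C`, `c`, `N`). -/
theorem stub_octantReduction : FirstOctantTubeFloor → TightTubeFloor := by
  rintro ⟨C, c, hC, hc, H⟩
  refine ⟨C, c, hC, hc, fun u v => ?_⟩
  have main : ∀ w : Site 2, ∃ N : ℕ,
      c * (max 1 (dist (Site.toComplex (0 : Site 2)) (Site.toComplex w))) ^ (-C) ≤
        Negative.tubeMass criticalFugacity 0 w
          (max 1 (dist (Site.toComplex (0 : Site 2)) (Site.toComplex w)) / 10 + 2) N := by
    refine octant_induction (P := fun w => ∃ N : ℕ,
      c * (max 1 (dist (Site.toComplex (0 : Site 2)) (Site.toComplex w))) ^ (-C) ≤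
        Negative.tubeMass criticalFugacity 0 w
          (max 1 (dist (Site.toComplex (0 : Site 2)) (Site.toComplex w)) / 10 + 2) N) ?_ ?_ ?_ ?_
    · rintro w ⟨N, hN⟩
      obtain ⟨hd, ht⟩ := symm_negX w
      rw [hd, ht] at hN
      exact ⟨N, hN⟩
    · rintro w ⟨N, hN⟩
      obtain ⟨hd, ht⟩ := symm_negY w
      rw [hd, ht] at hN
      exact ⟨N, hN⟩
    · rintro w ⟨N, hN⟩
      obtain ⟨hd, ht⟩ := symm_swap w
      rw [hd, ht] at hN
      exact ⟨N, hN⟩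
    · intro a b hab
      obtain ⟨N, hN⟩ := H a b hab
      refine ⟨N, ?_⟩
      rw [tubeMass_zero_eq]
      exact hN
  obtain ⟨N, hN⟩ := main (v - u)
  refine ⟨N, ?_⟩
  rw [dist_translate u v]
  rw [← tubeMass_translate criticalFugacity u v] at hN
  exact hN

end Summit.CriticalPhenomena.SAWScalingLimit.Theorems.TubeLowerBound.LiebSimonStar

end
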